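import Literature.MathematicalPhysics.QuantumFieldTheory.VillainKacSiegertTorus
import Literature.Probability.LatticeModels.FrohlichSpencerEnsembleExpansion
import HarnessLib

/-!
# Projection of ensembles onto closed current densities by the torus average
# (Fröhlich–Spencer (2.43)–(2.44) made exact)

Support file for the Coulomb-gas (monopole) representation of four-dimensional `U(1)` lattice gauge
theory with the Villain action (proof programme of the named fact
`Literature.MathematicalPhysics.QuantumFieldTheory.FrohlichSpencerU1PerimeterLawD4` and of its
corollary `Literature.Barriers.QuantumFields.AbelianDeconfinementD4`). In the regulator-free form of
the monopole gas (`VillainKacSiegertTorus`) the closedness constraint is carried by a torus variable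
`b` on the 4-cells, entering the phases through `2πEᵀb`. After the expansion into ensembles
(`FrohlichSpencerEnsembleExpansion`, FS82 Lemma 2) each term is a product over current densities
`ρ` of factors `1 + K(ρ) cos(ρ(α) + ρ(2πEᵀb))`, and — provided the integer 4-cell fields `dρ` of
distinct members of the ensemble have DISJOINT supports (which the separation of a 1-ensemble
guarantees, see `VillainRenormalisation`) — the `b`-average kills exactly the factors of the
NON-CLOSED densities:

* `phase_add_right`, `phase_eq_dotProduct`, `phase_torusShift` (`ρ(2πEᵀb) = 2π⟨dρ, b⟩`);
* `cosCoef`/`sum_cosCoef_cexp` (`1 + K cos θ = ∑_{s ∈ {0,±1}} c_s e^{isθ}`);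
* `EDisjoint`, `sum_smul_EInt_eq_zero_iff` (locality: `∑_ρ s_ρ dρ = 0 ↔ ∀ρ, s_ρ = 0 ∨ dρ = 0`);
* **`integral_torus_ensembleProd`**:
  `∫_{[0,1)^Q} ∏_{ρ∈𝒩} (1 + K(ρ) cos ρ(α + 2πEᵀb)) db = ∏_{ρ∈𝒩} (1 + [dρ = 0] K(ρ) cos ρ(α))`
  — FS82's "δρ = 0 for all ρ ∈ 𝒩, unless the term has zero weight", as an identity.

Everything is proved; no named fact is introduced.

## References

* J. Fröhlich, T. Spencer, Comm. Math. Phys. 83 (1982) 411–454, §2.6 (2.41)–(2.44).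
  [FrohlichSpencerCMP1982]
-/

noncomputable section

open Finset Function Matrix Filter Topology MeasureTheory Complex Set
open scoped Real
open Literature.Probability.LatticeModels
open Literature.Probability.LatticeModels.EnsembleExpansion (phase ensembleProd)

namespace Literature.MathematicalPhysics.QuantumFieldTheory

namespace VillainAngle

open AxialGauge LatticeForm LatticeChain VillainFibre

variable {d n : ℕ}

/-! ### Phases -/

/-- The phase is additive in the field. [folklore] -/
theorem phase_add_right {B : Type*} (ρ : B →₀ ℤ) (α α' : B → ℝ) : phase ρ (α + α') = phase ρ α + phase ρ α' := by
  simp only [phase, Finsupp.sum, Pi.add_apply, mul_add, Finset.sum_add_distrib]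

/-- The phase as a dot product (finite index type). [folklore] -/
theorem phase_eq_dotProduct {B : Type*} [Fintype B] (ρ : B →₀ ℤ) (α : B → ℝ) :
    phase ρ α = (fun b => (ρ b : ℝ)) ⬝ᵥ α := by
  classical
  rw [phase, Finsupp.sum, dotProduct, ← Finset.sum_subset (Finset.subset_univ ρ.support)]
  intro b _ hb
  rw [Finsupp.notMem_support_iff.1 hb, Int.cast_zero, zero_mul]

/-- **The torus enters the phase of `ρ` through `dρ`**: `ρ(2πEᵀb) = 2π ∑_σ (dρ)_σ b_σ`. [folklore] -/
theorem phase_torusShift (ρ : CIdx d n →₀ ℤ) (b : QIdx d n → ℝ) :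
    phase ρ (torusShift b) = 2 * π * ∑ σ, (EInt ρ σ : ℝ) * b σ := by
  rw [phase_eq_dotProduct, dotProduct_torusShift, EMat_mulVec_intCast, dotProduct]

/-! ### One factor: `1 + K cos θ` as a sum over `{0, ±1}` -/

/-- The coefficients `c_0 = 1`, `c_{±1} = K/2`. [folklore] -/
def cosCoef (K : ℝ) (s : SignType) : ℂ := if s = 0 then 1 else ((K / 2 : ℝ) : ℂ)

/-- `1 + K cos θ = ∑_{s ∈ {0,±1}} c_s e^{isθ}`. [folklore] -/
theorem sum_cosCoef_cexp (K θ : ℝ) :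
    ∑ s : SignType, cosCoef K s * cexp (I * (((s : ℤ) * θ : ℝ) : ℂ)) = ((1 + K * Real.cos θ : ℝ) : ℂ) := by
  rw [EnsembleExpansion.sum_signType]
  simp only [cosCoef, if_true, show (1 : SignType) ≠ 0 by decide, show (-1 : SignType) ≠ 0 by decide, if_false,
    SignType.coe_zero, SignType.coe_one, SignType.coe_neg_one, Int.cast_zero, Int.cast_one, Int.cast_neg,
    zero_mul, one_mul, neg_mul, Complex.ofReal_zero, mul_zero, Complex.exp_zero, mul_one]
  have hcos : cexp (I * ((-θ : ℝ) : ℂ)) + cexp (I * ((θ : ℝ) : ℂ)) = ((2 * Real.cos θ : ℝ) : ℂ) := by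
    rw [mul_comm I, mul_comm I, Complex.exp_mul_I, Complex.exp_mul_I, Complex.ofReal_neg, Complex.cos_neg,
      Complex.sin_neg]
    push_cast
    ring
  rw [add_assoc, ← mul_add, hcos]
  push_cast
  ring

/-! ### Locality: disjoint coboundaries -/

/-- The coboundaries `dρ` of distinct members of the family have disjoint supports. [folklore] -/
def EDisjoint (N : Finset (CIdx d n →₀ ℤ)) : Prop :=
  ∀ ρ ∈ N, ∀ ρ' ∈ N, ρ ≠ ρ' → ∀ σ : QIdx d n, EInt ρ σ = 0 ∨ EInt ρ' σ = 0

/-- **Locality**: for a family with disjoint coboundaries, a signed sum of the coboundaries vanishes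
iff each term does. [cite: FrohlichSpencerCMP1982, §2.6 (2.43)–(2.44)] -/
theorem sum_smul_EInt_eq_zero_iff {N : Finset (CIdx d n →₀ ℤ)} (hN : EDisjoint N) (s : ↥N → SignType) :
    (∀ σ : QIdx d n, ∑ ρ : ↥N, ((s ρ : ℤ) * EInt (ρ : CIdx d n →₀ ℤ) σ) = 0) ↔
      ∀ ρ : ↥N, s ρ = 0 ∨ EInt (ρ : CIdx d n →₀ ℤ) = 0 := by
  classical
  constructor
  · intro h ρ
    by_contra hcon
    push Not at hcon
    obtain ⟨hs, hE⟩ := hcon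
    obtain ⟨σ, hσ⟩ : ∃ σ, EInt (ρ : CIdx d n →₀ ℤ) σ ≠ 0 := Function.ne_iff.1 hE
    have hsum := h σ
    rw [← Finset.sum_erase_add _ _ (Finset.mem_univ ρ), Finset.sum_eq_zero, zero_add] at hsum
    · rcases mul_eq_zero.1 hsum with h0 | h0
      · apply hs
        cases hsv : s ρ with
        | zero => rfl
        | neg => simp [hsv] at h0
        | pos => simp [hsv] at h0
      · exact hσ h0
    · intro ρ' hρ'
      have hne : (ρ' : CIdx d n →₀ ℤ) ≠ ρ := fun heq => (Finset.mem_erase.1 hρ').1 (Subtype.ext heq)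
      rcases hN ρ' ρ'.2 ρ ρ.2 hne σ with h0 | h0
      · rw [h0, mul_zero]
      · exact absurd h0 hσ
  · intro h σ
    refine Finset.sum_eq_zero fun ρ _ => ?_
    rcases h ρ with h0 | h0
    · rw [h0, SignType.coe_zero, zero_mul]
    · rw [h0, Pi.zero_apply, mul_zero]

/-! ### The projection identity -/

/-- The integer 4-cell vector of a sign pattern: `k_s = ∑_ρ s_ρ dρ`. [folklore] -/
def signedE (N : Finset (CIdx d n →₀ ℤ)) (s : ↥N → SignType) : QIdx d n → ℤ :=
  fun σ => ∑ ρ : ↥N, (s ρ : ℤ) * EInt (ρ : CIdx d n →₀ ℤ) σ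

/-- Continuous functions are integrable on the half-open unit box. [folklore] -/
theorem integrableOn_box_of_continuous {E : Type*} [NormedAddCommGroup E] {f : (QIdx d n → ℝ) → E} (hf : Continuous f) :
    IntegrableOn f (Set.pi univ (fun _ : QIdx d n => Ico (0 : ℝ) 1)) := by
  refine IntegrableOn.mono_set (hf.continuousOn.integrableOn_compact (isCompact_univ_pi fun _ => isCompact_Icc))
    (Set.pi_mono fun _ _ => Ico_subset_Icc_self)

open Classical in
/-- **Projection onto closed densities by the torus average** (FS82 (2.43)–(2.44) as an identity):
for a finite family `𝒩` of current densities with disjoint coboundaries, real activities `K` and any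
field `α`,
`∫_{[0,1)^Q} ∏_{ρ∈𝒩} (1 + K(ρ) cos ρ(α + 2πEᵀb)) db = ∏_{ρ∈𝒩} (1 + [dρ = 0] K(ρ) cos ρ(α))`.
[cite: FrohlichSpencerCMP1982, §2.6 (2.43)–(2.44)] -/
theorem integral_torus_ensembleProd (N : Finset (CIdx d n →₀ ℤ)) (hN : EDisjoint N) (K : (CIdx d n →₀ ℤ) → ℝ)
    (α : CIdx d n → ℝ) :
    ∫ b in Set.pi univ (fun _ : QIdx d n => Ico (0 : ℝ) 1), ensembleProd N K (α + torusShift b) =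
      ensembleProd N (fun ρ => if EInt ρ = 0 then K ρ else 0) α := by
  -- the factor of `ρ` at sign `t`
  set G : ↥N → SignType → ℂ := fun ρ t =>
    cosCoef (K ρ) t * cexp (I * (((t : ℤ) * phase (ρ : CIdx d n →₀ ℤ) α : ℝ) : ℂ)) with hG
  set C : (↥N → SignType) → ℂ := fun s => ∏ ρ : ↥N, G ρ (s ρ) with hC
  -- Step 1: the integrand as a finite sum of characters of the torus
  have h1 : ∀ b : QIdx d n → ℝ, ((ensembleProd N K (α + torusShift b) : ℝ) : ℂ) =
      ∑ s : ↥N → SignType, C s * cexp (I * ((2 * π * ∑ σ, (signedE N s σ : ℝ) * b σ : ℝ) : ℂ)) := by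
    intro b
    rw [ensembleProd, ← Finset.prod_coe_sort, Complex.ofReal_prod]
    have hfac : ∀ ρ : ↥N, (((1 + K ρ * Real.cos (phase (ρ : CIdx d n →₀ ℤ) (α + torusShift b))) : ℝ) : ℂ) =
        ∑ t : SignType, G ρ t * cexp (I * (((t : ℤ) * phase (ρ : CIdx d n →₀ ℤ) (torusShift b) : ℝ) : ℂ)) := by
      intro ρ
      rw [← sum_cosCoef_cexp]
      refine Finset.sum_congr rfl fun t _ => ?_
      rw [hG]
      simp only
      rw [mul_assoc, ← Complex.exp_add, phase_add_right]
      congr 2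
      push_cast
      ring
    simp_rw [hfac]
    rw [Finset.prod_univ_sum, Fintype.piFinset_univ]
    refine Finset.sum_congr rfl fun s _ => ?_
    rw [Finset.prod_mul_distrib, ← Complex.exp_sum]
    congr 2
    rw [← Finset.mul_sum, ← Complex.ofReal_sum]
    congr 2
    simp_rw [phase_torusShift, signedE]
    push_cast
    simp_rw [Finset.mul_sum, Finset.sum_mul]
    rw [Finset.sum_comm]
    refine Finset.sum_congr rfl fun σ _ => ?_
    simp_rw [Finset.mul_sum]
    exact Finset.sum_congr rfl fun ρ _ => by ring
  -- Step 2: integrate the characters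
  have h2 : (((∫ b in Set.pi univ (fun _ : QIdx d n => Ico (0 : ℝ) 1), ensembleProd N K (α + torusShift b)) : ℝ) : ℂ) =
      ∑ s : ↥N → SignType, C s * (if signedE N s = 0 then 1 else 0) := by
    rw [← integral_complex_ofReal]
    simp_rw [h1]
    rw [integral_finsetSum _ fun s _ => ?_]
    · refine Finset.sum_congr rfl fun s _ => ?_
      rw [integral_const_mul, integral_torus_cexp]
    · refine integrableOn_box_of_continuous (continuous_const.mul (Complex.continuous_exp.comp
        (continuous_const.mul (continuous_ofReal.comp (continuous_const.mul ?_)))))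
      exact continuous_finsetSum _ fun σ _ => continuous_const.mul (continuous_apply σ)
  -- Step 3: locality and resummation
  have h3 : ∀ s : ↥N → SignType, (C s * if signedE N s = 0 then 1 else 0) =
      ∏ ρ : ↥N, (G ρ (s ρ) * if (s ρ = 0 ∨ EInt (ρ : CIdx d n →₀ ℤ) = 0) then 1 else 0) := by
    intro s
    have hiff : signedE N s = 0 ↔ ∀ ρ : ↥N, s ρ = 0 ∨ EInt (ρ : CIdx d n →₀ ℤ) = 0 := by
      rw [← sum_smul_EInt_eq_zero_iff hN s]
      exact ⟨fun h σ => congrFun h σ, fun h => funext h⟩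
    rw [Finset.prod_mul_distrib, Finset.prod_boole, hC]
    simp only [Finset.mem_univ, forall_const]
    rw [if_congr hiff rfl rfl]
  have h4 : ∀ ρ : ↥N, ∑ t : SignType, (G ρ t * if (t = 0 ∨ EInt (ρ : CIdx d n →₀ ℤ) = 0) then 1 else 0) =
      (((1 + (if EInt (ρ : CIdx d n →₀ ℤ) = 0 then K ρ else 0) * Real.cos (phase (ρ : CIdx d n →₀ ℤ) α)) : ℝ) : ℂ) := by
    intro ρ
    by_cases hE : EInt (ρ : CIdx d n →₀ ℤ) = 0
    · simp only [hE, or_true, if_true, mul_one]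
      rw [hG]
      exact sum_cosCoef_cexp (K ρ) _
    · simp only [hE, or_false, if_false]
      rw [EnsembleExpansion.sum_signType]
      simp [hG, cosCoef]
  apply Complex.ofReal_injective
  rw [h2]
  simp_rw [h3]
  rw [← Fintype.piFinset_univ, ← Finset.prod_univ_sum (fun _ => (Finset.univ : Finset SignType))
    (fun ρ t => G ρ t * if (t = 0 ∨ EInt (ρ : CIdx d n →₀ ℤ) = 0) then (1 : ℂ) else 0)]
  simp_rw [h4]
  rw [ensembleProd, ← Finset.prod_coe_sort N, Complex.ofReal_prod]

/-! ### Locality of the coboundary and separation of 1-ensembles -/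

/-- **The coarse adjacency on cubes**: distinct cubes whose base points are coordinatewise within
distance one (this contains "share a face", "share a 4-cell", "touch"). [folklore] -/
def adjC (c c' : CIdx d n) : Prop := c ≠ c' ∧ ∀ m : Fin d, |c.1.1 m - c'.1.1 m| ≤ 1

/-- `adjC` is symmetric. [folklore] -/
theorem adjC_symm (c c' : CIdx d n) (h : adjC c c') : adjC c' c :=
  ⟨fun heq => h.1 heq.symm, fun m => by rw [abs_sub_comm]; exact h.2 m⟩

/-- A point `y` is a "corner above `x`": coordinatewise `y_m ∈ {x_m, x_m + 1}`. [folklore] -/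
def NearPt (x y : Literature.Probability.LatticeModels.Site d) : Prop := ∀ m : Fin d, y m = x m ∨ y m = x m + 1

/-- `x` is near itself. [folklore] -/
theorem nearPt_self (x : Literature.Probability.LatticeModels.Site d) : NearPt x x := fun _ => Or.inl rfl

/-- `x + eᵢ` is near `x`. [folklore] -/
theorem nearPt_add_e (x : Literature.Probability.LatticeModels.Site d) (i : Fin d) : NearPt x (x + e i) := by
  intro m
  by_cases hm : m = i
  · subst hm; right; simp [e]
  · left; simp [e, hm]

/-- Two points near the same `x` are coordinatewise within distance one. [folklore] -/
theorem abs_sub_le_one_of_nearPt {x y y' : Literature.Probability.LatticeModels.Site d} (hy : NearPt x y) (hy' : NearPt x y')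
    (m : Fin d) : |y m - y' m| ≤ 1 := by
  rcases hy m with h | h <;> rcases hy' m with h' | h' <;> rw [h, h'] <;> simp

/-- A non-zero extended value comes from a cube of the box in the support. [folklore] -/
theorem exists_of_extCubeA_ne_zero {ρ : CIdx d n → ℤ} {y : Literature.Probability.LatticeModels.Site d} {a b c : Fin d}
    (h : extCubeA ρ y a b c ≠ 0) : ∃ hc : (y, a, b, c) ∈ cubesIn (halfOpenBox d n), ρ ⟨(y, a, b, c), hc⟩ ≠ 0 := by
  unfold extCubeA at h
  split_ifs at h with hc
  · exact ⟨hc, h⟩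
  · exact absurd rfl h

/-- **Locality of `d`**: if `(dρ)(σ) ≠ 0` then some cube of the support of `ρ` is a face of `σ`
(its base point is a corner above the base point of `σ`). [folklore] -/
theorem exists_mem_support_of_EInt_ne_zero (ρ : CIdx d n →₀ ℤ) (σ : QIdx d n) (h : EInt ρ σ ≠ 0) :
    ∃ c ∈ ρ.support, NearPt σ.1.1 c.1.1 := by
  by_contra hall
  push Not at hall
  have hz : ∀ (y : Literature.Probability.LatticeModels.Site d) (a b c : Fin d), NearPt σ.1.1 y →
      extCubeA (ρ : CIdx d n → ℤ) y a b c = 0 := by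
    intro y a b c hy
    by_contra hne
    obtain ⟨hc, hρ⟩ := exists_of_extCubeA_ne_zero hne
    exact hall ⟨(y, a, b, c), hc⟩ (Finsupp.mem_support_iff.2 hρ) hy
  apply h
  simp only [EInt, cd₃]
  rw [hz _ _ _ _ (nearPt_add_e _ _), hz _ _ _ _ (nearPt_self _), hz _ _ _ _ (nearPt_add_e _ _),
    hz _ _ _ _ (nearPt_self _), hz _ _ _ _ (nearPt_add_e _ _), hz _ _ _ _ (nearPt_self _),
    hz _ _ _ _ (nearPt_add_e _ _), hz _ _ _ _ (nearPt_self _)]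
  simp

/-- **1-ensembles have disjoint coboundaries** (the separation needed for the projection).
[cite: FrohlichSpencerCMP1982, §2.6 (2.43)–(2.44)] -/
theorem eDisjoint_of_isOneEnsemble {N : Finset (CIdx d n →₀ ℤ)} (hN : EnsembleExpansion.IsOneEnsemble adjC N) :
    EDisjoint N := by
  intro ρ hρ ρ' hρ' hne σ
  by_contra hcon
  push Not at hcon
  obtain ⟨c, hc, hyc⟩ := exists_mem_support_of_EInt_ne_zero ρ σ hcon.1
  obtain ⟨c', hc', hyc'⟩ := exists_mem_support_of_EInt_ne_zero ρ' σ hcon.2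
  obtain ⟨hcc', hnadj⟩ := hN ρ hρ ρ' hρ' hne c hc c' hc'
  exact hnadj ⟨hcc', fun m => abs_sub_le_one_of_nearPt hyc hyc' m⟩

end VillainAngle

end Literature.MathematicalPhysics.QuantumFieldTheory
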